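import Summits.QuantumFields.BalabanUV.Beta.GAN24.DerivativeRateTransferAnalyticKKT

/-!
# `BalabanUV.Beta.GAN24.DerivativeRateTransferAnalyticKKTCurve` — binder row G-an2-4 ∕ (CONV-C), route R6 «VALUES, NOT DERIVATIVES», PART 14:
# THE KKT DICTIONARY ALONG CURVES — for DIFFERENTIABLE CURVES of bordered data `s ↦ (H(s), Q(s))` (not only affine lines: Bałaban's backgrounds enter
# through `U = exp(isB′)`, AN1.md Table T rows T1–T8), an1's `jet₁ (H s₀) (Q s₀) (H′ s₀) (Q′ s₀)` IS the derivative of `s ↦ (kkt (H s) (Q s))⁻¹`, the block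
# rows are `dFlucCov ∕ dMinOp ∕ dMinOpL ∕ dEffForm` at the velocity `(H′, Q′)`, and along a `C²` curve the SECOND derivative of the effective form ∕
# minimiser is an1's full `minOp_effForm_line_taylor₂` coefficient: ONE second-order vertex `d𝒮(H″, Q″)` PLUS TWICE the two-vertex word
# (unit b2b-balaban-gan24-p3, gen 35; v1)

NOT IN PRINT; OUR PROOF (for the ROUTE; [folklore] matrix calculus over PART 12 (`hasDerivAt_matrix_inv`, `hasDerivAt_entry`, `hasDerivAt_of_entries`) and
an1's `Beta.BorderedJets` BY NAME; hypotheses ENTRYWISE so that no matrix norm enters a statement a consumer must match).  HONEST FRAMING (cell contract,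
verbatim): «discharging `BetaPertH` makes Bałaban's UV stability UNCONDITIONAL — a real constructive-QFT result; it is NOT the continuum limit and NOT
the Clay problem.»  HONEST DEPENDENCY (verbatim): «continuum YM on T⁴ ⇐ BetaPertH ∧ nine spine estimates (0/9 proved); BetaPertH ⇐ (D1) ∧ (D4) ∧
CAP+tail; G-an2-4 gates asym, D1 and NE2/3/4.»

WHY THIS FILE.  PART 12 read the dictionary along AFFINE lines `H + sH₁` — enough for the first-order rows and for the mixed row of the affine two-bond
family, but the (MF′) data are NOT affine in the background: `K = Δ^{(k)}(U_B)`, whose first term `H₁(U_B)ᵀΔ₁(U_B)H₁(U_B)` ([Balaban1987RG1] (1.5)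
p. 261, first term — the PATTERN of an1's `effForm` ∕ `Envelope.transpose_minMap_mul_mul_minMap`; KIND only, nothing printed is used) and the constraint
`Q = Q_k(U_B)` depend on the background through `U_B = exp(isB′)·V` (AN1.md Table T rows T4, T7, T8), so the second-order u-rows `K_{uu}` see the
CURVATURE `H″(0)` of the data curve — an1's `minOp_effForm_line_taylor₂` carries exactly this term (`d𝒮(2)` for the polynomial line `H + tH₁ + t²H₂`).  THIS FILE is the curve form of the dictionary: first order at the velocity, second order = second-order vertex + twice
the two-vertex word, for any `RCLike 𝕜` (road FP's `FP/EffectiveFormJets.hasDerivAt_effFormJet` is the `ℝ`, CONSTRAINT-FIXED case).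

WHAT THIS FILE PROVES (0 sorry, 0 `def`; `𝕜` any `RCLike` field; curves `H : 𝕜 → Matrix ν ν 𝕜`, `Q : 𝕜 → Matrix μ ν 𝕜` with ENTRYWISE derivatives):
* §1 `hasDerivAt_kkt_curve` (the bordered curve has derivative `kkt H′ Q′`), **`hasDerivAt_kktInv_curve`** (`jet₁ (H s₀) (Q s₀) H′ Q′` IS the derivative of
  `s ↦ (kkt (H s) (Q s))⁻¹` at a nonsingular `s₀`), the block rows **`hasDerivAt_flucCov_curve ∕ hasDerivAt_minOp_curve ∕ hasDerivAt_minOpL_curve ∕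
  hasDerivAt_effForm_curve`**.
* §2 `continuousAt_det_kkt_curve`, `eventually_isUnit_det_kkt_curve` (nonsingular locus open along a continuous curve — Leibniz expansion, no matrix norm),
  **`hasDerivAt_jet₁_curve`** (along a `C²` curve with velocity curve `(H₁ s, Q₁ s)` and acceleration `(H₂, Q₂)` at `s₀`:
  the derivative of `s ↦ jet₁ (H s) (Q s) (H₁ s) (Q₁ s)` is `2 • jet₂ δ δ + jet₁ (H s₀) (Q s₀) H₂ Q₂`, `δ = (H₁ s₀, Q₁ s₀)`),
  `deriv_effForm_curve_eventuallyEq` ∕ `deriv_minOp_curve_eventuallyEq`, **`deriv_deriv_effForm_curve`** (`(𝒮 ∘ γ)″(s₀) i j = (d𝒮(H₂,Q₂) + 2·((ℋᴸH₁ − 𝒮Q₁)·dℋ(H₁,Q₁) − ℋᴸQ₁ᵀ·d𝒮(H₁,Q₁))) i j` — an1's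
  `minOp_effForm_line_taylor₂` coefficient, `neg_jet₂_toBlocks₂₂` BY NAME), **`deriv_deriv_minOp_curve`** (`jet₂_toBlocks₁₂`).
WHAT IT DOES NOT DO: any size statement; the concrete curves `U_B = exp(isB′)` of Table T ((T-def)) — WHICH curve of bordered data is [B12]'s background
family is NOT asserted here (a dictionary to an1's JETS only; gan24-idea-1 W-idea1-g32-1); PART 7's transfer for curve families is PART 7 itself
(`F k s := 𝒮(H_k s, Q_k s) i j` is a one-parameter holomorphic family as soon as the entries of `H_k, Q_k` are — PART 12 `differentiableAt_inv_entry` at `E = 𝕜`).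
SUPPLIER work on route R6 (rank 2, KEEP-AS-REDUCTION, no seat); NEVER «G-an2-4 closed»; NOT (CONV-C), NOT D1, NOT `BetaPertH`, NOT continuum, NOT Clay.
Records: `HOME/b2b-balaban-gan24-p3/WOODBURY-FIBRE.md` v13.5.
-/

noncomputable section

namespace Summit.QuantumFields.BalabanUV.Beta.GAN24.DerivativeRateTransferAnalyticKKTCurve

open Matrix Filter
open scoped Matrix.Norms.Operator Topology
open Literature.MathematicalPhysics.QuantumFieldTheory.Balaban1983to89.Beta.Composition (kkt)
open Literature.MathematicalPhysics.QuantumFieldTheory.Balaban1983to89.Beta.CompositionSingular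
  (flucCov minOp minOpL effForm)
open Literature.MathematicalPhysics.QuantumFieldTheory.Balaban1983to89.Beta.BorderedJets
  (dressed jet₁ jet₂ dFlucCov dMinOp dMinOpL dEffForm jet₂_toBlocks₁₂ neg_jet₂_toBlocks₂₂)
open Summit.QuantumFields.BalabanUV.Beta.GAN24.DerivativeRateTransferAnalyticKKT
  (hasDerivAt_entry hasDerivAt_of_entries hasDerivAt_matrix_inv)

variable {𝕜 : Type*} [RCLike 𝕜]
variable {ν μ : Type*} [Fintype ν] [Fintype μ] [DecidableEq ν] [DecidableEq μ]

/-! ## §1 First order along a differentiable curve of bordered data -/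

section FirstOrder

variable {H : 𝕜 → Matrix ν ν 𝕜} {Q : 𝕜 → Matrix μ ν 𝕜} {H' : Matrix ν ν 𝕜} {Q' : Matrix μ ν 𝕜} {s₀ : 𝕜}

/-- [folklore] the bordered curve `s ↦ kkt (H s) (Q s)` has derivative `kkt H′ Q′` (entrywise hypotheses; `kkt = fromBlocks H Qᵀ Q 0`). -/
theorem hasDerivAt_kkt_curve (hH : ∀ i j, HasDerivAt (fun s => H s i j) (H' i j) s₀) (hQ : ∀ i j, HasDerivAt (fun s => Q s i j) (Q' i j) s₀) :
    HasDerivAt (fun s => kkt (H s) (Q s)) (kkt H' Q') s₀ := by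
  refine hasDerivAt_of_entries fun k l => ?_
  rcases k with i | i <;> rcases l with j | j
  · simpa [kkt, Matrix.fromBlocks_apply₁₁] using hH i j
  · simpa [kkt, Matrix.fromBlocks_apply₁₂, Matrix.transpose_apply] using hQ j i
  · simpa [kkt, Matrix.fromBlocks_apply₂₁] using hQ i j
  · simpa [kkt, Matrix.fromBlocks_apply₂₂] using hasDerivAt_const s₀ (0 : 𝕜)

/-- **`hasDerivAt_kktInv_curve` — an1's FIRST B-JET AT THE VELOCITY IS THE DERIVATIVE OF THE BORDERED INVERSE ALONG ANY DIFFERENTIABLE CURVE** [our proof]: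
`HasDerivAt (s ↦ (kkt (H s) (Q s))⁻¹) (jet₁ (H s₀) (Q s₀) H′ Q′) s₀` at a nonsingular `s₀`. -/
theorem hasDerivAt_kktInv_curve (hH : ∀ i j, HasDerivAt (fun s => H s i j) (H' i j) s₀) (hQ : ∀ i j, HasDerivAt (fun s => Q s i j) (Q' i j) s₀)
    (hdet : IsUnit (kkt (H s₀) (Q s₀)).det) :
    HasDerivAt (fun s => (kkt (H s) (Q s))⁻¹) (jet₁ (H s₀) (Q s₀) H' Q') s₀ := by
  have hd := hasDerivAt_matrix_inv (hasDerivAt_kkt_curve hH hQ) hdet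
  refine hd.congr_deriv ?_
  simp only [jet₁, dressed]

/-- **THE FLUCTUATION-COVARIANCE ROW along a curve**: entries of `s ↦ 𝒢(H s, Q s)` have derivatives the entries of `dFlucCov (H s₀) (Q s₀) H′ Q′`. [our proof] -/
theorem hasDerivAt_flucCov_curve (hH : ∀ i j, HasDerivAt (fun s => H s i j) (H' i j) s₀) (hQ : ∀ i j, HasDerivAt (fun s => Q s i j) (Q' i j) s₀)
    (hdet : IsUnit (kkt (H s₀) (Q s₀)).det) (i j : ν) :
    HasDerivAt (fun s => flucCov (H s) (Q s) i j) (dFlucCov (H s₀) (Q s₀) H' Q' i j) s₀ :=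
  hasDerivAt_entry (hasDerivAt_kktInv_curve hH hQ hdet) (Sum.inl i) (Sum.inl j)

/-- **THE MINIMISER ROW along a curve**: entries of `s ↦ ℋ(H s, Q s)` have derivatives the entries of `dMinOp (H s₀) (Q s₀) H′ Q′`. [our proof] -/
theorem hasDerivAt_minOp_curve (hH : ∀ i j, HasDerivAt (fun s => H s i j) (H' i j) s₀) (hQ : ∀ i j, HasDerivAt (fun s => Q s i j) (Q' i j) s₀)
    (hdet : IsUnit (kkt (H s₀) (Q s₀)).det) (i : ν) (j : μ) :
    HasDerivAt (fun s => minOp (H s) (Q s) i j) (dMinOp (H s₀) (Q s₀) H' Q' i j) s₀ :=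
  hasDerivAt_entry (hasDerivAt_kktInv_curve hH hQ hdet) (Sum.inl i) (Sum.inr j)

/-- **THE LEFT-MINIMISER ROW along a curve**. [our proof] -/
theorem hasDerivAt_minOpL_curve (hH : ∀ i j, HasDerivAt (fun s => H s i j) (H' i j) s₀) (hQ : ∀ i j, HasDerivAt (fun s => Q s i j) (Q' i j) s₀)
    (hdet : IsUnit (kkt (H s₀) (Q s₀)).det) (i : μ) (j : ν) :
    HasDerivAt (fun s => minOpL (H s) (Q s) i j) (dMinOpL (H s₀) (Q s₀) H' Q' i j) s₀ :=
  hasDerivAt_entry (hasDerivAt_kktInv_curve hH hQ hdet) (Sum.inr i) (Sum.inl j)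

/-- **THE EFFECTIVE-FORM ROW along a curve**: entries of `s ↦ 𝒮(H s, Q s)` have derivatives the entries of `dEffForm (H s₀) (Q s₀) H′ Q′ =
ℋᴸ·H′·ℋ − 𝒮·Q′·ℋ − ℋᴸ·Q′ᵀ·𝒮`. [our proof] -/
theorem hasDerivAt_effForm_curve (hH : ∀ i j, HasDerivAt (fun s => H s i j) (H' i j) s₀) (hQ : ∀ i j, HasDerivAt (fun s => Q s i j) (Q' i j) s₀)
    (hdet : IsUnit (kkt (H s₀) (Q s₀)).det) (i j : μ) :
    HasDerivAt (fun s => effForm (H s) (Q s) i j) (dEffForm (H s₀) (Q s₀) H' Q' i j) s₀ :=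
  (hasDerivAt_entry (hasDerivAt_kktInv_curve hH hQ hdet) (Sum.inr i) (Sum.inr j)).neg

end FirstOrder

/-! ## §2 Second order along a `C²` curve: second-order vertex plus twice the two-vertex word -/

section SecondOrder

variable {H H₁ : 𝕜 → Matrix ν ν 𝕜} {Q Q₁ : 𝕜 → Matrix μ ν 𝕜} {H₂ : Matrix ν ν 𝕜} {Q₂ : Matrix μ ν 𝕜} {s₀ : 𝕜}

/-- [folklore] `s ↦ det (kkt (H s) (Q s))` is continuous at a point where the entries of `H`, `Q` are (Leibniz expansion; no matrix norm). -/
theorem continuousAt_det_kkt_curve (hH : ∀ i j, ContinuousAt (fun s => H s i j) s₀) (hQ : ∀ i j, ContinuousAt (fun s => Q s i j) s₀) :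
    ContinuousAt (fun s => (kkt (H s) (Q s)).det) s₀ := by
  have hent : ∀ k l, ContinuousAt (fun s => kkt (H s) (Q s) k l) s₀ := by
    intro k l
    rcases k with i | i <;> rcases l with j | j
    · simpa [kkt, Matrix.fromBlocks_apply₁₁] using hH i j
    · simpa [kkt, Matrix.fromBlocks_apply₁₂, Matrix.transpose_apply] using hQ j i
    · simpa [kkt, Matrix.fromBlocks_apply₂₁] using hQ i j
    · simp [kkt, Matrix.fromBlocks_apply₂₂, continuousAt_const]
  simp only [Matrix.det_apply']
  refine tendsto_finsetSum _ fun σ _ => (tendsto_const_nhds.mul (tendsto_finsetProd _ fun i _ => hent (σ i) i))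

/-- [folklore] **THE NONSINGULAR LOCUS IS OPEN ALONG A CONTINUOUS CURVE**: nonsingular at `s₀` ⇒ nonsingular for `s` near `s₀`. -/
theorem eventually_isUnit_det_kkt_curve (hH : ∀ i j, ContinuousAt (fun s => H s i j) s₀) (hQ : ∀ i j, ContinuousAt (fun s => Q s i j) s₀)
    (hdet : IsUnit (kkt (H s₀) (Q s₀)).det) : ∀ᶠ s in 𝓝 s₀, IsUnit (kkt (H s) (Q s)).det :=
  ((continuousAt_det_kkt_curve hH hQ).eventually_ne hdet.ne_zero).mono fun _ hs => isUnit_iff_ne_zero.2 hs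

/-- **`hasDerivAt_jet₁_curve` — SECOND ORDER ALONG A `C²` CURVE** [our proof]: if the data curve has entrywise velocity `(H₁ s₀, Q₁ s₀)` at `s₀`, the
velocity curve has entrywise derivative `(H₂, Q₂)` at `s₀`, and `kkt (H s₀) (Q s₀)` is nonsingular, then
`s ↦ jet₁ (H s) (Q s) (H₁ s) (Q₁ s)` has derivative `2 • jet₂ (…) δ δ + jet₁ (H s₀) (Q s₀) H₂ Q₂` at `s₀` (`δ = (H₁ s₀, Q₁ s₀)`): twice the two-vertex jet PLUS
the first jet at the ACCELERATION — an1's `kktInv_line_taylor₂` `t²`-coefficient, differentiated form. -/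
theorem hasDerivAt_jet₁_curve (hH : ∀ i j, HasDerivAt (fun s => H s i j) (H₁ s₀ i j) s₀) (hQ : ∀ i j, HasDerivAt (fun s => Q s i j) (Q₁ s₀ i j) s₀)
    (hH₁ : ∀ i j, HasDerivAt (fun s => H₁ s i j) (H₂ i j) s₀) (hQ₁ : ∀ i j, HasDerivAt (fun s => Q₁ s i j) (Q₂ i j) s₀)
    (hdet : IsUnit (kkt (H s₀) (Q s₀)).det) :
    HasDerivAt (fun s => jet₁ (H s) (Q s) (H₁ s) (Q₁ s))
      ((2 : 𝕜) • jet₂ (H s₀) (Q s₀) (H₁ s₀) (Q₁ s₀) (H₁ s₀) (Q₁ s₀) + jet₁ (H s₀) (Q s₀) H₂ Q₂) s₀ := by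
  have hI := hasDerivAt_kktInv_curve hH hQ hdet
  have hV := hasDerivAt_kkt_curve (H := H₁) (Q := Q₁) hH₁ hQ₁
  have h3 : HasDerivAt (fun s => -((kkt (H s) (Q s))⁻¹ * kkt (H₁ s) (Q₁ s) * (kkt (H s) (Q s))⁻¹))
      (-((jet₁ (H s₀) (Q s₀) (H₁ s₀) (Q₁ s₀) * kkt (H₁ s₀) (Q₁ s₀) + (kkt (H s₀) (Q s₀))⁻¹ * kkt H₂ Q₂) * (kkt (H s₀) (Q s₀))⁻¹
        + (kkt (H s₀) (Q s₀))⁻¹ * kkt (H₁ s₀) (Q₁ s₀) * jet₁ (H s₀) (Q s₀) (H₁ s₀) (Q₁ s₀))) s₀ :=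
    ((hI.mul hV).mul hI).neg
  refine (h3.congr_of_eventuallyEq (Eventually.of_forall fun s => ?_)).congr_deriv ?_
  · simp only [jet₁, dressed]
  · simp only [two_smul, jet₂, jet₁, dressed, neg_mul, mul_neg, neg_add, neg_neg, Matrix.add_mul, Matrix.mul_assoc]
    abel

/-- [our proof] near `s₀`, the derivative FUNCTION of an effective-form entry along the curve is the `dEffForm` row at the velocity (for this the
velocity must exist NEAR `s₀`: `hH`, `hQ` eventually). -/
theorem deriv_effForm_curve_eventuallyEq (hH : ∀ᶠ s in 𝓝 s₀, ∀ i j, HasDerivAt (fun s' => H s' i j) (H₁ s i j) s)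
    (hQ : ∀ᶠ s in 𝓝 s₀, ∀ i j, HasDerivAt (fun s' => Q s' i j) (Q₁ s i j) s) (hdet : IsUnit (kkt (H s₀) (Q s₀)).det) (i j : μ) :
    (fun s => deriv (fun s' => effForm (H s') (Q s') i j) s) =ᶠ[𝓝 s₀] fun s => dEffForm (H s) (Q s) (H₁ s) (Q₁ s) i j := by
  have hHc : ∀ i j, ContinuousAt (fun s => H s i j) s₀ := fun i j => (hH.self_of_nhds i j).continuousAt
  have hQc : ∀ i j, ContinuousAt (fun s => Q s i j) s₀ := fun i j => (hQ.self_of_nhds i j).continuousAt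
  filter_upwards [hH, hQ, eventually_isUnit_det_kkt_curve hHc hQc hdet] with s hs hq hd
  exact (hasDerivAt_effForm_curve hs hq hd i j).deriv

/-- [our proof] the same for the minimiser entries. -/
theorem deriv_minOp_curve_eventuallyEq (hH : ∀ᶠ s in 𝓝 s₀, ∀ i j, HasDerivAt (fun s' => H s' i j) (H₁ s i j) s)
    (hQ : ∀ᶠ s in 𝓝 s₀, ∀ i j, HasDerivAt (fun s' => Q s' i j) (Q₁ s i j) s) (hdet : IsUnit (kkt (H s₀) (Q s₀)).det) (i : ν) (j : μ) :
    (fun s => deriv (fun s' => minOp (H s') (Q s') i j) s) =ᶠ[𝓝 s₀] fun s => dMinOp (H s) (Q s) (H₁ s) (Q₁ s) i j := by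
  have hHc : ∀ i j, ContinuousAt (fun s => H s i j) s₀ := fun i j => (hH.self_of_nhds i j).continuousAt
  have hQc : ∀ i j, ContinuousAt (fun s => Q s i j) s₀ := fun i j => (hQ.self_of_nhds i j).continuousAt
  filter_upwards [hH, hQ, eventually_isUnit_det_kkt_curve hHc hQc hdet] with s hs hq hd
  exact (hasDerivAt_minOp_curve hs hq hd i j).deriv

/-- **`deriv_deriv_effForm_curve` — THE SECOND u-ROW OF THE EFFECTIVE FORM ALONG A `C²` CURVE, IN an1's LETTERS** [our proof]: with velocity curve
`(H₁, Q₁)` near `s₀` and acceleration `(H₂, Q₂)` at `s₀` (entrywise), at a nonsingular `s₀`: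
`(𝒮 ∘ γ)″(s₀) i j = (d𝒮(H₂,Q₂) + 2·((ℋᴸH₁ − 𝒮Q₁)·dℋ(H₁,Q₁) − ℋᴸQ₁ᵀ·d𝒮(H₁,Q₁))) i j` (blocks of `(H s₀, Q s₀)`; `H₁ = H₁ s₀`, `Q₁ = Q₁ s₀`) — ONE
second-order vertex plus TWICE the two-vertex word of `minOp_effForm_line_taylor₂` (there the line is `H + tH₁ + t²H₂`, i.e. `H″ = 2H₂`). -/
theorem deriv_deriv_effForm_curve (hH : ∀ᶠ s in 𝓝 s₀, ∀ i j, HasDerivAt (fun s' => H s' i j) (H₁ s i j) s)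
    (hQ : ∀ᶠ s in 𝓝 s₀, ∀ i j, HasDerivAt (fun s' => Q s' i j) (Q₁ s i j) s)
    (hH₁ : ∀ i j, HasDerivAt (fun s => H₁ s i j) (H₂ i j) s₀) (hQ₁ : ∀ i j, HasDerivAt (fun s => Q₁ s i j) (Q₂ i j) s₀)
    (hdet : IsUnit (kkt (H s₀) (Q s₀)).det) (i j : μ) :
    deriv (fun s => deriv (fun s' => effForm (H s') (Q s') i j) s) s₀ =
      (dEffForm (H s₀) (Q s₀) H₂ Q₂
        + (2 : 𝕜) • ((minOpL (H s₀) (Q s₀) * H₁ s₀ - effForm (H s₀) (Q s₀) * Q₁ s₀) * dMinOp (H s₀) (Q s₀) (H₁ s₀) (Q₁ s₀)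
          - minOpL (H s₀) (Q s₀) * (Q₁ s₀)ᵀ * dEffForm (H s₀) (Q s₀) (H₁ s₀) (Q₁ s₀))) i j := by
  rw [(deriv_effForm_curve_eventuallyEq hH hQ hdet i j).deriv_eq]
  have hJ := hasDerivAt_jet₁_curve (hH.self_of_nhds) (hQ.self_of_nhds) hH₁ hQ₁ hdet
  have hd := ((hasDerivAt_entry hJ (Sum.inr i) (Sum.inr j)).neg).deriv
  have hd' : deriv (fun s => dEffForm (H s) (Q s) (H₁ s) (Q₁ s) i j) s₀ =
      -(((2 : 𝕜) • jet₂ (H s₀) (Q s₀) (H₁ s₀) (Q₁ s₀) (H₁ s₀) (Q₁ s₀) + jet₁ (H s₀) (Q s₀) H₂ Q₂) (Sum.inr i) (Sum.inr j)) := hd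
  rw [hd', ← neg_jet₂_toBlocks₂₂]
  simp only [dEffForm, Matrix.add_apply, Matrix.neg_apply, Matrix.smul_apply, Matrix.toBlocks₂₂, Matrix.of_apply, smul_eq_mul]
  ring

/-- **`deriv_deriv_minOp_curve` — THE SECOND u-ROW OF THE MINIMISER ALONG A `C²` CURVE** [our proof]:
`(ℋ ∘ γ)″(s₀) i j = (dℋ(H₂,Q₂) + 2·(−(𝒢H₁ + ℋQ₁)·dℋ(H₁,Q₁) + 𝒢Q₁ᵀ·d𝒮(H₁,Q₁))) i j` (`BorderedJets.jet₂_toBlocks₁₂`). -/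
theorem deriv_deriv_minOp_curve (hH : ∀ᶠ s in 𝓝 s₀, ∀ i j, HasDerivAt (fun s' => H s' i j) (H₁ s i j) s)
    (hQ : ∀ᶠ s in 𝓝 s₀, ∀ i j, HasDerivAt (fun s' => Q s' i j) (Q₁ s i j) s)
    (hH₁ : ∀ i j, HasDerivAt (fun s => H₁ s i j) (H₂ i j) s₀) (hQ₁ : ∀ i j, HasDerivAt (fun s => Q₁ s i j) (Q₂ i j) s₀)
    (hdet : IsUnit (kkt (H s₀) (Q s₀)).det) (i : ν) (j : μ) :
    deriv (fun s => deriv (fun s' => minOp (H s') (Q s') i j) s) s₀ =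
      (dMinOp (H s₀) (Q s₀) H₂ Q₂
        + (2 : 𝕜) • (-((flucCov (H s₀) (Q s₀) * H₁ s₀ + minOp (H s₀) (Q s₀) * Q₁ s₀) * dMinOp (H s₀) (Q s₀) (H₁ s₀) (Q₁ s₀))
          + flucCov (H s₀) (Q s₀) * (Q₁ s₀)ᵀ * dEffForm (H s₀) (Q s₀) (H₁ s₀) (Q₁ s₀))) i j := by
  rw [(deriv_minOp_curve_eventuallyEq hH hQ hdet i j).deriv_eq]
  have hJ := hasDerivAt_jet₁_curve (hH.self_of_nhds) (hQ.self_of_nhds) hH₁ hQ₁ hdet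
  have hd := (hasDerivAt_entry hJ (Sum.inl i) (Sum.inr j)).deriv
  have hd' : deriv (fun s => dMinOp (H s) (Q s) (H₁ s) (Q₁ s) i j) s₀ =
      ((2 : 𝕜) • jet₂ (H s₀) (Q s₀) (H₁ s₀) (Q₁ s₀) (H₁ s₀) (Q₁ s₀) + jet₁ (H s₀) (Q s₀) H₂ Q₂) (Sum.inl i) (Sum.inr j) := hd
  rw [hd', ← jet₂_toBlocks₁₂]
  simp only [dMinOp, Matrix.add_apply, Matrix.smul_apply, Matrix.toBlocks₁₂, Matrix.of_apply, smul_eq_mul]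
  ring

end SecondOrder

end Summit.QuantumFields.BalabanUV.Beta.GAN24.DerivativeRateTransferAnalyticKKTCurve

end
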